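import Summits.KontsevichZagierPeriods.KontsevichZagierPeriods.Theorems.AbelContractionRealHyperellipticSectorDefs

/-!
# Route AbelContraction — `RealHyperellipticSector` (crux stmt-KontsevichZagierPeriods-12475): sign of the root gaps

Helper file of the line `Lines/birth.lean` (registered brick `engine_root_gap_sign` of the stub
`stub_engine`, `--supports` the crux). The separating pencil `c_u = λN + uD` of degree `g + 1`
has `g + 1` simple real roots `x 0 < x 1 < ⋯ < x g` (one per oval), and its derivative at the
`j`-th root is `c_u′(x j) = (λ + u) ∏_{m ≠ j} (x j − x m)`. This file records the sign of that
product: among the factors `x j − x m`, `m ≠ j`, exactly those with `m > j` are negative, and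
there are `g − j` of them, so `(−1)^(g − j) ∏_{m ≠ j} (x j − x m) > 0`.

References: M. Kontsevich, D. Zagier, *Periods* (2001), §1.2 [KontsevichZagier2001];
B. Gross, J. Harris, *Real algebraic curves*, Ann. Sci. ÉNS 14 (1981), §3 [GrossHarris1981].
No definitions are introduced.
-/

noncomputable section

open Set
open Literature.NumberTheory.Transcendental

namespace Summit.KontsevichZagierPeriods.AbelContraction.RealHyperellipticSector

/-- **Sign of the root gaps**: for strictly increasing reals `x 0 < x 1 < ⋯ < x g` and an index
`j ≤ g`, the product `∏_{m ≠ j} (x j − x m)` has exactly `g − j` negative factors (those with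
`m > j`), hence `(−1)^(g − j) · ∏_{m ≠ j} (x j − x m) > 0`. [folklore] -/
theorem engine_root_gap_sign : ∀ (g : ℕ) (x : Fin (g + 1) → ℝ), StrictMono x → ∀ j : Fin (g + 1),
    0 < (-1 : ℝ) ^ (g - (j : ℕ)) * ∏ m ∈ Finset.univ.erase j, (x j - x m) := by
  intro g x hx j
  -- split the index set `{m ≠ j}` into `{m < j}` and `{m > j}`
  have hsplit : Finset.univ.erase j = Finset.Iio j ∪ Finset.Ioi j := by
    ext m
    simp only [Finset.mem_erase, Finset.mem_univ, and_true, Finset.mem_union, Finset.mem_Iio,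
      Finset.mem_Ioi]
    exact ne_iff_lt_or_gt
  have hdisj : Disjoint (Finset.Iio j) (Finset.Ioi j) :=
    Finset.disjoint_left.mpr fun m hm hm' =>
      lt_asymm (Finset.mem_Iio.mp hm) (Finset.mem_Ioi.mp hm')
  -- the block `m > j` has `g - j` factors, each the negative of a positive gap
  have hcard : (Finset.Ioi j).card = g - (j : ℕ) := by
    rw [Fin.card_Ioi]
    omega
  have hneg : ∏ m ∈ Finset.Ioi j, (x j - x m) =
      (-1) ^ (g - (j : ℕ)) * ∏ m ∈ Finset.Ioi j, (x m - x j) := by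
    rw [← hcard, ← Finset.prod_neg]
    exact Finset.prod_congr rfl fun m _ => (neg_sub _ _).symm
  have hsq : (-1 : ℝ) ^ (g - (j : ℕ)) * (-1) ^ (g - (j : ℕ)) = 1 := by
    rw [← pow_add, ← two_mul, pow_mul, neg_one_sq, one_pow]
  rw [hsplit, Finset.prod_union hdisj, hneg, mul_left_comm (∏ m ∈ Finset.Iio j, (x j - x m)),
    ← mul_assoc, hsq, one_mul]
  exact mul_pos (Finset.prod_pos fun m hm => sub_pos.mpr (hx (Finset.mem_Iio.mp hm)))
    (Finset.prod_pos fun m hm => sub_pos.mpr (hx (Finset.mem_Ioi.mp hm)))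

end Summit.KontsevichZagierPeriods.AbelContraction.RealHyperellipticSector

end
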